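import Literature.NumberTheory.LFunctions.RudnickSarnakNPairIntegral
import Literature.NumberTheory.LFunctions.RudnickSarnakNSmoothedLimit
import HarnessLib

/-!
# Rudnick–Sarnak `n`-level correlations for `ζ`: the limit functional is `∫ Φ C_O`

Sibling file of `Literature/NumberTheory/LFunctions/RudnickSarnak.lean` (toward
`Literature.NumberTheory.LFunctions.rudnick_sarnak_unrestricted`, Rudnick–Sarnak 1996, Theorem 3.2
for `ζ`, at every level). The combinatorial identification of the limit of the windowed sums
(`RudnickSarnakN.Unsmooth.frontLimit`, file `RudnickSarnakNSmoothedLimit.lean`: the sum over density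
sets `D`, negative sides `P ⊆ Dᶜ` and matchings `β : P ≃ Dᶜ ∖ P` of the pair integrals
`I_β(Φ) = ∫_{v > 0} Π v_p Φ(Σ v_p (e_{βp} − e_p))`, `RudnickSarnakN.pairInt_eq_integral_pairs`) with
Rudnick–Sarnak's diagonal-pairing functional (3.9),
`∫ Φ C_O = Σ_{M} ∫_{ℝ^M} Π |v_p| Φ(Σ v_p e_{i(p), j(p)})` (`rsPairingFunctional`):

  `frontLimit k Φ = rsPairingFunctional (k + 1) Φ`   (`Φ` continuous of compact support)

(`RudnickSarnakN.Unsmooth.frontLimit_eq_rsPairingFunctional`). Both sides are rewritten as the sum,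
over *oriented* matchings `A` (sets of arrows `a → b`, `a ≠ b`, with pairwise disjoint supports), of
`J(A) = ∫_{w > 0} Π w Φ(Σ_{(a,b) ∈ A} w_{(a,b)} (e_b − e_a))`: on the right by splitting `ℝ^M` into
its `2^{|M|}` orthants and reflecting (the arrow of a pair `i < j` points to `i` on `v > 0` and to `j`
on `v < 0`), on the left by sending `(D, P, β)` to the graph `{(p, βp)}` of the matching.

## References

* Z. Rudnick, P. Sarnak, *Zeros of principal `L`-functions and random matrix theory*, Duke Math.
  J. 81 (1996), 269–322, (3.9), (3.74).
-/

noncomputable section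

open Complex Filter Set MeasureTheory Finset
open scoped Real Topology

namespace Literature.NumberTheory.LFunctions

namespace RudnickSarnakN

namespace Unsmooth

variable {k : ℕ}

/-! ## Oriented matchings and their integrals -/

/-- The vector `e_b − e_a` of an arrow `(a, b)`. [cite: RudnickSarnak1996, (3.10)] -/
def arrowVec (q : Fin (k + 1) × Fin (k + 1)) : Fin (k + 1) → ℝ :=
  Pi.single q.2 1 - Pi.single q.1 1

/-- An *oriented matching*: a set of arrows `(a, b)` with `a ≠ b` and pairwise disjoint supports
`{a, b}`. [folklore] -/
def IsOrientedMatching (A : Finset (Fin (k + 1) × Fin (k + 1))) : Prop :=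
  (∀ q ∈ A, q.1 ≠ q.2) ∧ (A : Set (Fin (k + 1) × Fin (k + 1))).PairwiseDisjoint fun q ↦ ({q.1, q.2} : Finset (Fin (k + 1)))

/-- The positive-orthant integral attached to a family of vectors `d`:
`J(d) = ∫_{w > 0} (Π w) Φ(Σ_i w_i d_i)`. [cite: RudnickSarnak1996, (3.74)] -/
def orthInt {ι : Type*} [Fintype ι] (d : ι → (Fin (k + 1) → ℝ)) (Φ : (Fin (k + 1) → ℝ) → ℂ) : ℂ :=
  ∫ w : ι → ℝ, ((orthProd w : ℝ) : ℂ) * Φ (∑ i, w i • d i)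

/-- The integral of an oriented matching: `J(A) = ∫_{w > 0} (Π w) Φ(Σ_{(a,b) ∈ A} w_{(a,b)} (e_b − e_a))`.
[cite: RudnickSarnak1996, (3.74)] -/
def matchInt (A : Finset (Fin (k + 1) × Fin (k + 1))) (Φ : (Fin (k + 1) → ℝ) → ℂ) : ℂ :=
  orthInt (fun q : ↥A ↦ arrowVec (q : Fin (k + 1) × Fin (k + 1))) Φ

/-- **Reindexing the orthant integral**: for `e : ι ≃ ι'` and `d' (e i) = d i`, `J(d') = J(d)`.
[folklore] -/
theorem orthInt_reindex {ι ι' : Type*} [Fintype ι] [Fintype ι'] (e : ι ≃ ι') (d : ι → (Fin (k + 1) → ℝ))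
    (d' : ι' → (Fin (k + 1) → ℝ)) (hd : ∀ i, d' (e i) = d i) (Φ : (Fin (k + 1) → ℝ) → ℂ) :
    orthInt d' Φ = orthInt d Φ := by
  classical
  unfold orthInt
  have hmp := volume_measurePreserving_piCongrLeft (fun _ : ι' ↦ ℝ) e
  rw [← hmp.integral_comp (MeasurableEquiv.piCongrLeft (fun _ : ι' ↦ ℝ) e).measurableEmbedding]
  refine integral_congr_ae (Eventually.of_forall fun v ↦ ?_)
  simp only
  have happ : ∀ i, (MeasurableEquiv.piCongrLeft (fun _ : ι' ↦ ℝ) e) v (e i) = v i := fun i ↦ by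
    rw [MeasurableEquiv.coe_piCongrLeft]; exact Equiv.piCongrLeft_apply_apply _ _ _ _
  congr 2
  · -- the orthant weight is reindexing invariant
    unfold orthProd
    have h1 : (∀ q : ι', 0 < (MeasurableEquiv.piCongrLeft (fun _ : ι' ↦ ℝ) e) v q) ↔ ∀ i : ι, 0 < v i := by
      constructor
      · intro h i; rw [← happ i]; exact h (e i)
      · intro h q; obtain ⟨i, rfl⟩ := e.surjective q; rw [happ]; exact h i
    have h2 : ∏ q : ι', (MeasurableEquiv.piCongrLeft (fun _ : ι' ↦ ℝ) e) v q = ∏ i : ι, v i := by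
      rw [← e.prod_comp]; exact Fintype.prod_congr _ _ happ
    by_cases h : ∀ i : ι, 0 < v i
    · rw [if_pos (h1.2 h), if_pos h, h2]
    · rw [if_neg (fun h' ↦ h (h1.1 h')), if_neg h]
  · rw [← e.sum_comp]
    exact Fintype.sum_congr _ _ fun i ↦ by rw [happ, hd]

/-! ## The right-hand side: orthants of `ℝ^M` -/

section RHS

variable (M : Finset (Fin (k + 1) × Fin (k + 1)))

/-- The sign vector of an orthant `T ⊆ M` (`−1` on `T`). [folklore] -/
def sgnT (T : Finset ↥M) (p : ↥M) : ℝ := if p ∈ T then -1 else 1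

/-- `σ² = 1`. [folklore] -/
theorem sgnT_mul_self (T : Finset ↥M) (p : ↥M) : sgnT M T p * sgnT M T p = 1 := by
  unfold sgnT; split_ifs <;> norm_num

/-- `|σ| = 1`. [folklore] -/
theorem abs_sgnT (T : Finset ↥M) (p : ↥M) : |sgnT M T p| = 1 := by
  unfold sgnT; split_ifs <;> norm_num

/-- The coordinate reflections of an orthant, as a measurable equivalence. [folklore] -/
def flipT (T : Finset ↥M) : (↥M → ℝ) ≃ᵐ (↥M → ℝ) where
  toFun g p := sgnT M T p * g p
  invFun g p := sgnT M T p * g p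
  left_inv g := by funext p; simp only; rw [← mul_assoc, sgnT_mul_self, one_mul]
  right_inv g := by funext p; simp only; rw [← mul_assoc, sgnT_mul_self, one_mul]
  measurable_toFun := measurable_pi_iff.2 fun p ↦ (measurable_pi_apply p).const_mul _
  measurable_invFun := measurable_pi_iff.2 fun p ↦ (measurable_pi_apply p).const_mul _

/-- `flipT` evaluated. [folklore] -/
theorem flipT_apply (T : Finset ↥M) (g : ↥M → ℝ) (p : ↥M) : flipT M T g p = sgnT M T p * g p := rfl

/-- The reflections are measure preserving. [folklore] -/
theorem measurePreserving_flipT (T : Finset ↥M) : MeasurePreserving (flipT M T) := by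
  have h1 : ∀ p : ↥M, MeasurePreserving (fun x : ℝ ↦ sgnT M T p * x) := by
    intro p
    unfold sgnT
    split_ifs
    · rw [show (fun x : ℝ ↦ (-1 : ℝ) * x) = Neg.neg from funext fun x ↦ neg_one_mul x]
      exact Measure.measurePreserving_neg _
    · rw [show (fun x : ℝ ↦ (1 : ℝ) * x) = id from funext fun x ↦ one_mul x]
      exact MeasurePreserving.id _
  exact volume_preserving_pi h1

/-- The open orthant of `T`: `v_p < 0` on `T`, `v_p > 0` off `T`. [folklore] -/
def orthant (T : Finset ↥M) : Set (↥M → ℝ) := {v | ∀ p, 0 < sgnT M T p * v p}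

/-- Orthants are open. [folklore] -/
theorem isOpen_orthant (T : Finset ↥M) : IsOpen (orthant M T) := by
  have : orthant M T = ⋂ p : ↥M, {v : ↥M → ℝ | 0 < sgnT M T p * v p} := by
    ext v; simp [orthant]
  rw [this]
  exact isOpen_iInter_of_finite fun p ↦ isOpen_lt continuous_const (continuous_const.mul (continuous_apply p))

/-- Off the coordinate hyperplanes every point lies in exactly one orthant: the sum of the orthant
indicators is `1`. [folklore] -/
theorem sum_indicator_orthant {v : ↥M → ℝ} (hv : ∀ p, v p ≠ 0) (f : (↥M → ℝ) → ℂ) :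
    ∑ T : Finset ↥M, (orthant M T).indicator f v = f v := by
  classical
  set T₀ : Finset ↥M := Finset.univ.filter fun p ↦ v p < 0
  have hmem : ∀ T : Finset ↥M, v ∈ orthant M T ↔ T = T₀ := by
    intro T
    constructor
    · intro h
      ext p
      simp only [T₀, Finset.mem_filter, Finset.mem_univ, true_and]
      have hp := h p
      unfold sgnT at hp
      split_ifs at hp with hpT
      · exact ⟨fun _ ↦ by linarith, fun _ ↦ hpT⟩
      · exact ⟨fun h' ↦ absurd h' hpT, fun h' ↦ by linarith⟩
    · rintro rfl p
      unfold sgnT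
      simp only [T₀, Finset.mem_filter, Finset.mem_univ, true_and]
      rcases lt_or_gt_of_ne (hv p) with h | h
      · rw [if_pos h]; linarith
      · rw [if_neg (not_lt.2 h.le)]; linarith
  rw [Finset.sum_eq_single T₀]
  · rw [Set.indicator_of_mem ((hmem T₀).2 rfl)]
  · intro T _ hT
    exact Set.indicator_of_notMem (fun h ↦ hT ((hmem T).1 h)) _
  · intro h; exact absurd (Finset.mem_univ _) h

/-- The coordinate hyperplanes are null: a.e. `v` has all coordinates non-zero. [folklore] -/
theorem ae_forall_ne_zero : ∀ᵐ v : ↥M → ℝ, ∀ p, v p ≠ 0 := by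
  rw [ae_all_iff]
  intro p
  have h : (volume : Measure (↥M → ℝ)) {v | v p = 0} = 0 := by
    rw [volume_pi]; exact Measure.pi_hyperplane _ p 0
  rw [ae_iff]
  simpa using h

/-- **Orthant decomposition and reflection**: for an integrable `f`,
`∫ f = Σ_T ∫ f(σ_T ⊙ u) 1[u > 0] du`. [folklore] -/
theorem integral_eq_sum_orthants {f : (↥M → ℝ) → ℂ} (hf : Integrable f) :
    ∫ v, f v = ∑ T : Finset ↥M, ∫ u : ↥M → ℝ, (orthant M ∅).indicator (fun u ↦ f (flipT M T u)) u := by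
  classical
  -- a.e. decomposition
  have h1 : ∫ v, f v = ∫ v, ∑ T : Finset ↥M, (orthant M T).indicator f v := by
    refine integral_congr_ae ?_
    filter_upwards [ae_forall_ne_zero M] with v hv
    exact (sum_indicator_orthant M hv f).symm
  rw [h1, integral_finsetSum _ fun T _ ↦ hf.indicator (isOpen_orthant M T).measurableSet]
  refine Finset.sum_congr rfl fun T _ ↦ ?_
  -- reflect the orthant `T` onto the positive orthant
  rw [← (measurePreserving_flipT M T).integral_comp (flipT M T).measurableEmbedding]
  refine integral_congr_ae (Eventually.of_forall fun u ↦ ?_)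
  simp only
  have hmem : flipT M T u ∈ orthant M T ↔ u ∈ orthant M ∅ := by
    simp only [orthant, Set.mem_setOf_eq, flipT_apply]
    refine forall_congr' fun p ↦ ?_
    rw [← mul_assoc, sgnT_mul_self, one_mul]
    unfold sgnT; simp
  by_cases h : u ∈ orthant M ∅
  · rw [Set.indicator_of_mem (hmem.2 h), Set.indicator_of_mem h]
  · rw [Set.indicator_of_notMem (fun h' ↦ h (hmem.1 h')), Set.indicator_of_notMem h]

/-- The positive orthant in terms of `orthant ∅`. [folklore] -/
theorem mem_orthant_empty {u : ↥M → ℝ} : u ∈ orthant M ∅ ↔ ∀ p, 0 < u p := by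
  simp [orthant, sgnT]

/-- **The RS integral of a matching, split into orthants**: for `Φ` with `v ↦ Π|v| Φ(Σ v e)`
integrable, `∫ Π|v_p| Φ(Σ v_p e_p) = Σ_T J((σ_T(p) e_p)_p)`. [cite: RudnickSarnak1996, (3.9)] -/
theorem integral_abs_prod_eq_sum_orthInt (Φ : (Fin (k + 1) → ℝ) → ℂ)
    (hint : Integrable fun v : ↥M → ℝ ↦ ((∏ p, |v p| : ℝ) : ℂ) * Φ (∑ p : ↥M, v p • rsBasisDiff (p : Fin (k + 1) × Fin (k + 1)))) :
    (∫ v : ↥M → ℝ, ((∏ p, |v p| : ℝ) : ℂ) * Φ (∑ p : ↥M, v p • rsBasisDiff (p : Fin (k + 1) × Fin (k + 1)))) =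
      ∑ T : Finset ↥M, orthInt (fun p : ↥M ↦ sgnT M T p • rsBasisDiff (p : Fin (k + 1) × Fin (k + 1))) Φ := by
  classical
  rw [integral_eq_sum_orthants M hint]
  refine Finset.sum_congr rfl fun T _ ↦ ?_
  unfold orthInt
  refine integral_congr_ae (Eventually.of_forall fun u ↦ ?_)
  simp only
  unfold orthProd
  by_cases h : ∀ p : ↥M, 0 < u p
  · rw [Set.indicator_of_mem ((mem_orthant_empty M).2 h), if_pos h]
    congr 2
    · refine Finset.prod_congr rfl fun p _ ↦ ?_
      rw [flipT_apply, abs_mul, abs_sgnT, one_mul, abs_of_pos (h p)]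
    · refine Finset.sum_congr rfl fun p _ ↦ ?_
      rw [flipT_apply, smul_smul, mul_comm]
  · rw [Set.indicator_of_notMem (fun h' ↦ h ((mem_orthant_empty M).1 h')), if_neg h]
    simp

end RHS

/-! ## Sorting arrows and the bijection `(M, T) ↔ A` -/

/-- The support of an arrow is symmetric. [folklore] -/
theorem pair_swap_eq {X : Type*} [DecidableEq X] (q : X × X) : ({q.swap.1, q.swap.2} : Finset X) = {q.1, q.2} := by
  simp [Finset.pair_comm]

section SortPairs

variable {X : Type*} [LinearOrder X]

/-- The sorted version of an arrow. [folklore] -/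
def sortPair (q : X × X) : X × X := if q.1 < q.2 then q else q.swap

/-- Sorted arrows are fixed. [folklore] -/
theorem sortPair_of_lt {q : X × X} (h : q.1 < q.2) : sortPair q = q := if_pos h

/-- Reversed arrows are swapped. [folklore] -/
theorem sortPair_of_gt {q : X × X} (h : q.2 < q.1) : sortPair q = q.swap := if_neg (not_lt.2 h.le)

/-- Sorting the reverse of a sorted arrow. [folklore] -/
theorem sortPair_swap_of_lt {q : X × X} (h : q.1 < q.2) : sortPair q.swap = q := by
  unfold sortPair; rw [if_neg (by simpa using h.le)]; rfl

/-- Sorted arrows are increasing. [folklore] -/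
theorem sortPair_fst_lt {q : X × X} (h : q.1 ≠ q.2) : (sortPair q).1 < (sortPair q).2 := by
  rcases lt_or_gt_of_ne h with h | h
  · rw [sortPair_of_lt h]; exact h
  · rw [sortPair_of_gt h]; exact h

/-- Sorting preserves the support. [folklore] -/
theorem pair_sortPair_eq [DecidableEq X] (q : X × X) : ({(sortPair q).1, (sortPair q).2} : Finset X) = {q.1, q.2} := by
  unfold sortPair; split_ifs
  · rfl
  · exact pair_swap_eq q

end SortPairs

section Bij

variable {M : Finset (Fin (k + 1) × Fin (k + 1))}

/-- The arrow of a pair of `M` in the orthant `T`: `p` itself on `T` (arrow `i → j`), the reversed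
pair off `T` (arrow `j → i`). [folklore] -/
def arrowOf (T : Finset ↥M) (p : ↥M) : Fin (k + 1) × Fin (k + 1) :=
  if p ∈ T then (p : Fin (k + 1) × Fin (k + 1)) else (p : Fin (k + 1) × Fin (k + 1)).swap

/-- The oriented matching of `(M, T)`. [folklore] -/
def orientOf (T : Finset ↥M) : Finset (Fin (k + 1) × Fin (k + 1)) :=
  Finset.univ.image (arrowOf T)

/-- `arrowVec (arrowOf T p) = σ_T(p) • e_p`. [folklore] -/
theorem arrowVec_arrowOf (T : Finset ↥M) (p : ↥M) :
    arrowVec (arrowOf T p) = sgnT M T p • rsBasisDiff (p : Fin (k + 1) × Fin (k + 1)) := by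
  unfold arrowVec arrowOf sgnT rsBasisDiff
  split_ifs
  · rw [neg_one_smul, neg_sub]
  · simp

/-- The support of `arrowOf T p` is the support of `p`. [folklore] -/
theorem pair_arrowOf (T : Finset ↥M) (p : ↥M) :
    ({(arrowOf T p).1, (arrowOf T p).2} : Finset (Fin (k + 1))) = {(p : Fin (k + 1) × Fin (k + 1)).1, (p : Fin (k + 1) × Fin (k + 1)).2} := by
  unfold arrowOf; split_ifs
  · rfl
  · exact pair_swap_eq _

/-- `sortPair (arrowOf T p) = p` for a pair of a partial matching. [folklore] -/
theorem sortPair_arrowOf (hM : IsPartialMatching M) (T : Finset ↥M) (p : ↥M) :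
    sortPair (arrowOf T p) = (p : Fin (k + 1) × Fin (k + 1)) := by
  have hp := hM.1 p p.2
  unfold arrowOf; split_ifs
  · exact sortPair_of_lt hp
  · exact sortPair_swap_of_lt hp

/-- In a partial matching, pairs with a common support point are equal. [folklore] -/
theorem pm_eq_of_not_disjoint (hM : IsPartialMatching M) {p p' : ↥M}
    (h : ¬ Disjoint ({(p : Fin (k + 1) × Fin (k + 1)).1, (p : Fin (k + 1) × Fin (k + 1)).2} : Finset (Fin (k + 1)))
      {(p' : Fin (k + 1) × Fin (k + 1)).1, (p' : Fin (k + 1) × Fin (k + 1)).2}) : p = p' := by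
  by_contra hne
  exact h (hM.2 p.2 p'.2 (fun h' ↦ hne (Subtype.ext h')))

/-- `arrowOf T` is injective. [folklore] -/
theorem arrowOf_injective (hM : IsPartialMatching M) (T : Finset ↥M) : Function.Injective (arrowOf T) := by
  intro p p' h
  refine pm_eq_of_not_disjoint hM ?_
  rw [← pair_arrowOf T p, ← pair_arrowOf T p', h]
  exact fun hd ↦ by simp at hd

/-- `orientOf T` is an oriented matching. [folklore] -/
theorem isOrientedMatching_orientOf (hM : IsPartialMatching M) (T : Finset ↥M) : IsOrientedMatching (orientOf T) := by
  constructor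
  · intro q hq
    unfold orientOf at hq
    rw [Finset.mem_image] at hq
    obtain ⟨p, -, rfl⟩ := hq
    have hp := hM.1 p p.2
    unfold arrowOf; split_ifs
    · exact hp.ne
    · exact hp.ne'
  · intro q hq q' hq' hne
    simp only [orientOf, Finset.coe_image, Finset.coe_univ, Set.image_univ, Set.mem_range] at hq hq'
    obtain ⟨p, rfl⟩ := hq
    obtain ⟨p', rfl⟩ := hq'
    have hpp' : p ≠ p' := fun h ↦ hne (by rw [h])
    have := hM.2 p.2 p'.2 (fun h ↦ hpp' (Subtype.ext h))
    simpa only [Function.onFun, pair_arrowOf] using this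

/-- Membership in `orientOf T`: `p ∈ M` lies in `orientOf T` iff `p ∈ T`. [folklore] -/
theorem coe_mem_orientOf_iff (hM : IsPartialMatching M) (T : Finset ↥M) (p : ↥M) :
    (p : Fin (k + 1) × Fin (k + 1)) ∈ orientOf T ↔ p ∈ T := by
  unfold orientOf
  rw [Finset.mem_image]
  constructor
  · rintro ⟨p', -, h⟩
    unfold arrowOf at h
    split_ifs at h with hp'
    · rwa [← Subtype.ext h]
    · exfalso
      have h1 := hM.1 p' p'.2
      have h2 := hM.1 p p.2
      rw [← h] at h2
      simp at h2
      exact absurd (h1.trans h2) (lt_irrefl _)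
  · intro hp
    exact ⟨p, Finset.mem_univ _, by unfold arrowOf; rw [if_pos hp]⟩

/-- `M` is recovered from `orientOf T` by sorting. [folklore] -/
theorem image_sortPair_orientOf (hM : IsPartialMatching M) (T : Finset ↥M) : (orientOf T).image sortPair = M := by
  ext q
  simp only [orientOf, Finset.mem_image, Finset.mem_univ, true_and]
  constructor
  · rintro ⟨a, ⟨p, rfl⟩, rfl⟩
    rw [sortPair_arrowOf hM]; exact p.2
  · intro hq
    exact ⟨arrowOf T ⟨q, hq⟩, ⟨⟨q, hq⟩, rfl⟩, sortPair_arrowOf hM T ⟨q, hq⟩⟩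

variable {A : Finset (Fin (k + 1) × Fin (k + 1))}

/-- In an oriented matching the reversed arrow is absent. [folklore] -/
theorem IsOrientedMatching.swap_not_mem (hA : IsOrientedMatching A) {q : Fin (k + 1) × Fin (k + 1)} (hq : q ∈ A) :
    q.swap ∉ A := by
  intro hq'
  have hne : q ≠ q.swap := by
    intro h
    have := hA.1 q hq
    rw [Prod.ext_iff] at h
    exact this h.1
  have := hA.2 hq hq' hne
  simp only [Function.onFun, pair_swap_eq] at this
  exact absurd this (by simp)

/-- The sorted matching of an oriented matching is a partial matching. [folklore] -/
theorem IsOrientedMatching.isPartialMatching_image (hA : IsOrientedMatching A) : IsPartialMatching (A.image sortPair) := by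
  constructor
  · intro p hp
    rw [Finset.mem_image] at hp
    obtain ⟨q, hq, rfl⟩ := hp
    exact sortPair_fst_lt (hA.1 q hq)
  · intro p hp p' hp' hne
    rw [Finset.coe_image] at hp hp'
    obtain ⟨q, hq, rfl⟩ := hp
    obtain ⟨q', hq', rfl⟩ := hp'
    have hqq' : q ≠ q' := fun h ↦ hne (by rw [h])
    have := hA.2 hq hq' hqq'
    simpa only [Function.onFun, pair_sortPair_eq] using this

/-- The orthant of an oriented matching, after sorting. [folklore] -/
def orthantOf (A : Finset (Fin (k + 1) × Fin (k + 1))) : Finset ↥(A.image sortPair) :=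
  Finset.univ.filter fun p ↦ (p : Fin (k + 1) × Fin (k + 1)) ∈ A

/-- An oriented matching is recovered from its sorted matching and its orthant. [folklore] -/
theorem orientOf_orthantOf (hA : IsOrientedMatching A) : orientOf (orthantOf A) = A := by
  ext q
  simp only [orientOf, Finset.mem_image, Finset.mem_univ, true_and]
  constructor
  · rintro ⟨p, rfl⟩
    obtain ⟨q₀, hq₀, hp⟩ : ∃ q₀ ∈ A, sortPair q₀ = (p : Fin (k + 1) × Fin (k + 1)) := by
      have := p.2; rw [Finset.mem_image] at this; exact this
    unfold arrowOf orthantOf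
    simp only [Finset.mem_filter, Finset.mem_univ, true_and]
    split_ifs with h
    · exact h
    · rcases lt_or_gt_of_ne (hA.1 q₀ hq₀) with hlt | hgt
      · rw [sortPair_of_lt hlt] at hp; rw [← hp] at h; exact absurd hq₀ h
      · rw [sortPair_of_gt hgt] at hp; rw [← hp]; simpa using hq₀
  · intro hq
    have hmem : sortPair q ∈ A.image sortPair := Finset.mem_image_of_mem _ hq
    refine ⟨⟨sortPair q, hmem⟩, ?_⟩
    unfold arrowOf orthantOf
    simp only [Finset.mem_filter, Finset.mem_univ, true_and]
    rcases lt_or_gt_of_ne (hA.1 q hq) with hlt | hgt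
    · simp only [sortPair_of_lt hlt, hq, if_true]
    · simp only [sortPair_of_gt hgt, hA.swap_not_mem hq, if_false]
      rfl

end Bij

/-! ## The right-hand side over oriented matchings -/

/-- The RS integrand of a matching is integrable for a continuous compactly supported `Φ`. [folklore] -/
theorem integrable_rsIntegrand {M : Finset (Fin (k + 1) × Fin (k + 1))} (hM : IsPartialMatching M)
    {Φ : (Fin (k + 1) → ℝ) → ℂ} (hΦc : Continuous Φ) (hΦs : HasCompactSupport Φ) :
    Integrable fun v : ↥M → ℝ ↦ ((∏ p, |v p| : ℝ) : ℂ) * Φ (∑ p : ↥M, v p • rsBasisDiff (p : Fin (k + 1) × Fin (k + 1))) := by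
  classical
  -- continuity
  have hlin : Continuous fun v : ↥M → ℝ ↦ ∑ p : ↥M, v p • rsBasisDiff (p : Fin (k + 1) × Fin (k + 1)) :=
    continuous_finsetSum _ fun p _ ↦ (continuous_apply p).smul continuous_const
  have hcont : Continuous fun v : ↥M → ℝ ↦ ((∏ p, |v p| : ℝ) : ℂ) * Φ (∑ p : ↥M, v p • rsBasisDiff (p : Fin (k + 1) × Fin (k + 1))) :=
    (Complex.continuous_ofReal.comp (continuous_finsetProd _ fun p _ ↦ (continuous_apply p).abs)).mul (hΦc.comp hlin)
  refine hcont.integrable_of_hasCompactSupport ?_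
  -- compact support: `|v_p| ≤ ‖Σ v e‖` coordinatewise (the first endpoint of `p` carries `v_p`)
  obtain ⟨R, hR⟩ := hΦs.isCompact.isBounded.subset_closedBall 0
  refine HasCompactSupport.of_support_subset_isCompact (isCompact_closedBall (0 : ↥M → ℝ) R) ?_
  intro v hv
  rw [Function.mem_support, mul_ne_zero_iff] at hv
  have hΦ := hv.2
  have hmem : (∑ p : ↥M, v p • rsBasisDiff (p : Fin (k + 1) × Fin (k + 1))) ∈ Metric.closedBall (0 : Fin (k + 1) → ℝ) R :=
    hR (subset_tsupport _ (Function.mem_support.2 hΦ))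
  rw [Metric.mem_closedBall, dist_zero_right] at hmem ⊢
  have hR0 : 0 ≤ R := (norm_nonneg _).trans hmem
  refine (pi_norm_le_iff_of_nonneg hR0).2 fun p ↦ ?_
  -- the coordinate `p.1` of the sum is `v p`
  have hcoord : (∑ p' : ↥M, v p' • rsBasisDiff (p' : Fin (k + 1) × Fin (k + 1))) (p : Fin (k + 1) × Fin (k + 1)).1 = v p := by
    rw [Finset.sum_apply, Finset.sum_eq_single p]
    · simp only [Pi.smul_apply, rsBasisDiff, Pi.sub_apply, smul_eq_mul]
      rw [Pi.single_eq_same, Pi.single_eq_of_ne (hM.1 p p.2).ne, sub_zero, mul_one]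
    · intro p' _ hne
      simp only [Pi.smul_apply, rsBasisDiff, Pi.sub_apply, smul_eq_mul]
      have hdis := hM.2 p'.2 p.2 (fun h ↦ hne (Subtype.ext h))
      simp only [Function.onFun, Finset.disjoint_insert_left, Finset.mem_insert, Finset.mem_singleton,
        Finset.disjoint_singleton_left, not_or] at hdis
      rw [Pi.single_eq_of_ne (Ne.symm hdis.1.1), Pi.single_eq_of_ne (Ne.symm hdis.2.1), sub_zero, mul_zero]
    · intro h; exact absurd (Finset.mem_univ p) h
  calc ‖v p‖ = ‖(∑ p' : ↥M, v p' • rsBasisDiff (p' : Fin (k + 1) × Fin (k + 1))) (p : Fin (k + 1) × Fin (k + 1)).1‖ := by rw [hcoord]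
    _ ≤ ‖∑ p' : ↥M, v p' • rsBasisDiff (p' : Fin (k + 1) × Fin (k + 1))‖ := norm_le_pi_norm _ _
    _ ≤ R := hmem

open scoped Classical in
/-- **`∫ Φ C_O` over oriented matchings**: for a continuous compactly supported `Φ`,
`rsPairingFunctional n Φ = Σ_{A oriented} J(A)`. [cite: RudnickSarnak1996, (3.9)] -/
theorem rsPairingFunctional_eq_sum_matchInt {Φ : (Fin (k + 1) → ℝ) → ℂ} (hΦc : Continuous Φ) (hΦs : HasCompactSupport Φ) :
    rsPairingFunctional (k + 1) Φ =
      ∑ A ∈ (Finset.univ : Finset (Finset (Fin (k + 1) × Fin (k + 1)))).filter IsOrientedMatching, matchInt A Φ := by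
  unfold rsPairingFunctional
  -- orthants
  have h1 : ∀ M ∈ (Finset.univ : Finset (Finset (Fin (k + 1) × Fin (k + 1)))).filter IsPartialMatching,
      (∫ v : ↥M → ℝ, ((∏ p, |v p| : ℝ) : ℂ) * Φ (∑ p : ↥M, v p • rsBasisDiff (p : Fin (k + 1) × Fin (k + 1)))) =
        ∑ T : Finset ↥M, matchInt (orientOf T) Φ := by
    intro M hM
    rw [Finset.mem_filter] at hM
    rw [integral_abs_prod_eq_sum_orthInt M Φ (integrable_rsIntegrand hM.2 hΦc hΦs)]
    refine Finset.sum_congr rfl fun T _ ↦ ?_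
    -- reindex `↥M ≃ ↥(orientOf T)`
    unfold matchInt
    set e : ↥M ≃ ↥(orientOf T) := Equiv.ofBijective
      (fun p ↦ ⟨arrowOf T p, Finset.mem_image_of_mem _ (Finset.mem_univ p)⟩)
      ⟨fun p p' h ↦ arrowOf_injective hM.2 T (congrArg Subtype.val h),
        fun q ↦ by
          obtain ⟨p, -, hp⟩ := Finset.mem_image.1 q.2
          exact ⟨p, Subtype.ext hp⟩⟩ with he
    refine (orthInt_reindex e _ _ (fun p ↦ ?_) Φ).symm
    show arrowVec (arrowOf T p) = sgnT M T p • rsBasisDiff (p : Fin (k + 1) × Fin (k + 1))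
    exact arrowVec_arrowOf T p
  rw [Finset.sum_congr rfl h1, Finset.sum_sigma']
  -- the bijection `(M, T) ↦ orientOf T`
  refine Finset.sum_bij (fun x _ ↦ orientOf x.2) ?_ ?_ ?_ ?_
  · intro x hx
    rw [Finset.mem_sigma, Finset.mem_filter] at hx
    rw [Finset.mem_filter]
    exact ⟨Finset.mem_univ _, isOrientedMatching_orientOf hx.1.2 x.2⟩
  · intro x hx x' hx' h
    rw [Finset.mem_sigma, Finset.mem_filter] at hx hx'
    obtain ⟨M, T⟩ := x
    obtain ⟨M', T'⟩ := x'
    simp only at h hx hx'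
    have hMM' : M = M' := by
      rw [← image_sortPair_orientOf hx.1.2 T, ← image_sortPair_orientOf hx'.1.2 T', h]
    subst hMM'
    have hTT' : T = T' := by
      ext p
      rw [← coe_mem_orientOf_iff hx.1.2 T p, ← coe_mem_orientOf_iff hx.1.2 T' p, h]
    rw [hTT']
  · intro A hA
    rw [Finset.mem_filter] at hA
    refine ⟨⟨A.image sortPair, orthantOf A⟩, ?_, orientOf_orthantOf hA.2⟩
    rw [Finset.mem_sigma, Finset.mem_filter]
    exact ⟨⟨Finset.mem_univ _, hA.2.isPartialMatching_image⟩, Finset.mem_univ _⟩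
  · intro x _; rfl

/-! ## The left-hand side over oriented matchings -/

section LHS

variable {D P : Finset (Fin (k + 1))}

/-- `βf` on `P` is `β`. [folklore] -/
theorem betaF_coe (β : ↥P ≃ ↥((Finset.univ \ D) \ P)) (p : ↥P) :
    betaF D P β (p : Fin (k + 1)) = ((β p : ↥((Finset.univ \ D) \ P)) : Fin (k + 1)) := by
  unfold betaF; rw [dif_pos p.2]

variable (D P) in
/-- The graph `{(p, βp) : p ∈ P}` of a matching. [folklore] -/
def graphOf (β : ↥P ≃ ↥((Finset.univ \ D) \ P)) : Finset (Fin (k + 1) × Fin (k + 1)) :=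
  Finset.univ.image fun p : ↥P ↦ ((p : Fin (k + 1)), ((β p : ↥((Finset.univ \ D) \ P)) : Fin (k + 1)))

/-- Membership in the graph. [folklore] -/
theorem mem_graphOf {β : ↥P ≃ ↥((Finset.univ \ D) \ P)} {q : Fin (k + 1) × Fin (k + 1)} :
    q ∈ graphOf D P β ↔ ∃ p : ↥P, ((p : Fin (k + 1)), ((β p : ↥((Finset.univ \ D) \ P)) : Fin (k + 1))) = q := by
  simp [graphOf]

/-- The graph of a matching is an oriented matching (`P ⊆ Dᶜ`). [folklore] -/
theorem isOrientedMatching_graphOf (β : ↥P ≃ ↥((Finset.univ \ D) \ P)) :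
    IsOrientedMatching (graphOf D P β) := by
  have hPQ : ∀ (p : ↥P) (p' : ↥P), (p : Fin (k + 1)) ≠ ((β p' : ↥((Finset.univ \ D) \ P)) : Fin (k + 1)) := by
    intro p p' h
    have := (Finset.mem_sdiff.1 (β p').2).2
    rw [← h] at this
    exact this p.2
  constructor
  · intro q hq
    obtain ⟨p, rfl⟩ := mem_graphOf.1 hq
    exact hPQ p p
  · intro q hq q' hq' hne
    obtain ⟨p, rfl⟩ := mem_graphOf.1 hq
    obtain ⟨p', rfl⟩ := mem_graphOf.1 hq'
    have hpp' : p ≠ p' := fun h ↦ hne (by rw [h])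
    simp only [Function.onFun, Finset.disjoint_insert_left, Finset.mem_insert, Finset.mem_singleton,
      Finset.disjoint_singleton_left, not_or]
    refine ⟨⟨fun h ↦ hpp' (Subtype.ext h), hPQ p p'⟩, fun h ↦ hPQ p' p h.symm, fun h ↦ hpp' ?_⟩
    exact β.injective (Subtype.ext h)

/-- `pairInt = J(graph)` (`P ⊆ Dᶜ`). [cite: RudnickSarnak1996, (3.74)] -/
theorem pairInt_eq_matchInt_graphOf (hP : P ⊆ Finset.univ \ D) (β : ↥P ≃ ↥((Finset.univ \ D) \ P))
    (Φ : (Fin (k + 1) → ℝ) → ℂ) : pairInt D P β Φ = matchInt (graphOf D P β) Φ := by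
  rw [pairInt_eq_integral_pairs hP]
  unfold matchInt
  set e : ↥P ≃ ↥(graphOf D P β) := Equiv.ofBijective
    (fun p ↦ ⟨((p : Fin (k + 1)), ((β p : ↥((Finset.univ \ D) \ P)) : Fin (k + 1))), mem_graphOf.2 ⟨p, rfl⟩⟩)
    ⟨fun p p' h ↦ Subtype.ext (congrArg Prod.fst (congrArg Subtype.val h)),
      fun q ↦ by obtain ⟨p, hp⟩ := mem_graphOf.1 q.2; exact ⟨p, Subtype.ext hp⟩⟩ with he
  show orthInt (fun p : ↥P ↦ dvec D P β p) Φ = orthInt (fun q : ↥(graphOf D P β) ↦ arrowVec (q : Fin (k + 1) × Fin (k + 1))) Φ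
  refine (orthInt_reindex e (fun p ↦ dvec D P β p) _ (fun p ↦ ?_) Φ).symm
  show arrowVec (((p : Fin (k + 1)), ((β p : ↥((Finset.univ \ D) \ P)) : Fin (k + 1)))) = dvec D P β p
  unfold arrowVec dvec; rw [betaF_coe]

/-- The source and target maps of an oriented matching are injective. [folklore] -/
theorem IsOrientedMatching.fst_injOn {A : Finset (Fin (k + 1) × Fin (k + 1))} (hA : IsOrientedMatching A) :
    ∀ q ∈ A, ∀ q' ∈ A, q.1 = q'.1 → q = q' := by
  intro q hq q' hq' h
  by_contra hne
  have := hA.2 hq hq' hne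
  simp only [Function.onFun, Finset.disjoint_insert_left, Finset.mem_insert, Finset.mem_singleton, not_or] at this
  exact this.1.1 h

/-- The target map of an oriented matching is injective. [folklore] -/
theorem IsOrientedMatching.snd_injOn {A : Finset (Fin (k + 1) × Fin (k + 1))} (hA : IsOrientedMatching A) :
    ∀ q ∈ A, ∀ q' ∈ A, q.2 = q'.2 → q = q' := by
  intro q hq q' hq' h
  by_contra hne
  have := hA.2 hq hq' hne
  simp only [Function.onFun, Finset.disjoint_insert_right, Finset.mem_insert, Finset.mem_singleton, not_or,
    Finset.disjoint_singleton_right] at this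
  exact this.2.2 h.symm

/-- Sources and targets of an oriented matching are disjoint. [folklore] -/
theorem IsOrientedMatching.fst_ne_snd {A : Finset (Fin (k + 1) × Fin (k + 1))} (hA : IsOrientedMatching A) :
    ∀ q ∈ A, ∀ q' ∈ A, q.1 ≠ q'.2 := by
  intro q hq q' hq' h
  by_cases hqq' : q = q'
  · subst hqq'; exact hA.1 q hq h
  · have := hA.2 hq hq' hqq'
    simp only [Function.onFun, Finset.disjoint_insert_left, Finset.mem_insert, Finset.mem_singleton, not_or] at this
    exact this.1.2 h

/-- The density set of an oriented matching: the complement of its support. [folklore] -/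
def densOf (A : Finset (Fin (k + 1) × Fin (k + 1))) : Finset (Fin (k + 1)) :=
  Finset.univ \ (A.image Prod.fst ∪ A.image Prod.snd)

/-- The complement of the density set is the support. [folklore] -/
theorem univ_sdiff_densOf (A : Finset (Fin (k + 1) × Fin (k + 1))) :
    Finset.univ \ densOf A = A.image Prod.fst ∪ A.image Prod.snd := by
  unfold densOf; ext a; simp

/-- Removing the sources from the support leaves the targets. [folklore] -/
theorem sdiff_sdiff_eq_image_snd {A : Finset (Fin (k + 1) × Fin (k + 1))} (hA : IsOrientedMatching A) :
    (Finset.univ \ densOf A) \ A.image Prod.fst = A.image Prod.snd := by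
  rw [univ_sdiff_densOf]
  ext b
  simp only [Finset.mem_sdiff, Finset.mem_union, Finset.mem_image]
  constructor
  · rintro ⟨h | h, hn⟩
    · exact absurd h hn
    · exact h
  · rintro ⟨q, hq, rfl⟩
    refine ⟨Or.inr ⟨q, hq, rfl⟩, ?_⟩
    rintro ⟨q', hq', h⟩
    exact hA.fst_ne_snd q' hq' q hq h

/-- For the graph of `(D, P, β)`: the sources are `P`. [folklore] -/
theorem image_fst_graphOf (β : ↥P ≃ ↥((Finset.univ \ D) \ P)) : (graphOf D P β).image Prod.fst = P := by
  ext a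
  simp only [Finset.mem_image, mem_graphOf]
  constructor
  · rintro ⟨q, ⟨p, rfl⟩, rfl⟩; exact p.2
  · intro ha; exact ⟨_, ⟨⟨a, ha⟩, rfl⟩, rfl⟩

/-- For the graph of `(D, P, β)`: the targets are `Dᶜ ∖ P`. [folklore] -/
theorem image_snd_graphOf (β : ↥P ≃ ↥((Finset.univ \ D) \ P)) :
    (graphOf D P β).image Prod.snd = (Finset.univ \ D) \ P := by
  ext b
  simp only [Finset.mem_image, mem_graphOf]
  constructor
  · rintro ⟨q, ⟨p, rfl⟩, rfl⟩; exact (β p).2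
  · intro hb; exact ⟨_, ⟨β.symm ⟨b, hb⟩, rfl⟩, by simp⟩

/-- For the graph of `(D, P, β)` with `P ⊆ Dᶜ`: the density set is `D`. [folklore] -/
theorem densOf_graphOf (hP : P ⊆ Finset.univ \ D) (β : ↥P ≃ ↥((Finset.univ \ D) \ P)) : densOf (graphOf D P β) = D := by
  unfold densOf
  rw [image_fst_graphOf, image_snd_graphOf, Finset.union_sdiff_of_subset hP]
  ext a; simp

open scoped Classical in
/-- **The front-end limit over oriented matchings**: `frontLimit k Φ = Σ_{A oriented} J(A)`.
[cite: RudnickSarnak1996, (3.74)] -/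
theorem frontLimit_eq_sum_matchInt (Φ : (Fin (k + 1) → ℝ) → ℂ) :
    frontLimit k Φ = ∑ A ∈ (Finset.univ : Finset (Finset (Fin (k + 1) × Fin (k + 1)))).filter IsOrientedMatching, matchInt A Φ := by
  unfold frontLimit
  rw [Finset.sum_sigma', Finset.sum_sigma']
  refine Finset.sum_bij (fun y _ ↦ graphOf y.1.1 y.1.2 y.2) ?_ ?_ ?_ ?_
  · -- lands in oriented matchings
    intro y _
    rw [Finset.mem_filter]
    exact ⟨Finset.mem_univ _, isOrientedMatching_graphOf y.2⟩
  · -- injective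
    intro y hy y' hy' h
    rw [Finset.mem_sigma, Finset.mem_sigma] at hy hy'
    obtain ⟨⟨D, P⟩, β⟩ := y
    obtain ⟨⟨D', P'⟩, β'⟩ := y'
    simp only at h hy hy' β β'
    have hP := Finset.mem_powerset.1 hy.1.2
    have hP' := Finset.mem_powerset.1 hy'.1.2
    have hDD' : D = D' := by rw [← densOf_graphOf hP β, ← densOf_graphOf hP' β', h]
    subst hDD'
    have hPP' : P = P' := by rw [← image_fst_graphOf β, ← image_fst_graphOf β', h]
    subst hPP'
    have hββ' : β = β' := by
      refine Equiv.ext fun p ↦ Subtype.ext ?_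
      have hmem : ((p : Fin (k + 1)), ((β p : ↥((Finset.univ \ D) \ P)) : Fin (k + 1))) ∈ graphOf D P β' := by
        rw [← h]; exact mem_graphOf.2 ⟨p, rfl⟩
      obtain ⟨p', hp'⟩ := mem_graphOf.1 hmem
      rw [Prod.ext_iff] at hp'
      obtain ⟨h1, h2⟩ := hp'
      simp only at h1 h2
      have : p' = p := Subtype.ext h1
      subst this
      exact h2.symm
    subst hββ'
    rfl
  · -- surjective
    intro A hA
    rw [Finset.mem_filter] at hA
    have hom := hA.2
    set P₀ : Finset (Fin (k + 1)) := A.image Prod.fst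
    set D₀ : Finset (Fin (k + 1)) := densOf A
    have hQ : (Finset.univ \ D₀) \ P₀ = A.image Prod.snd := sdiff_sdiff_eq_image_snd hom
    -- the two bijections `↥A ≃ ↥P₀`, `↥A ≃ ↥Q₀`
    set fstE : ↥A ≃ ↥P₀ := Equiv.ofBijective (fun q ↦ ⟨q.1.1, Finset.mem_image_of_mem _ q.2⟩)
      ⟨fun q q' h ↦ Subtype.ext (hom.fst_injOn _ q.2 _ q'.2 (congrArg Subtype.val h)),
        fun a ↦ by
          obtain ⟨q, hq, hqa⟩ := Finset.mem_image.1 a.2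
          exact ⟨⟨q, hq⟩, Subtype.ext hqa⟩⟩ with hfstE
    set sndE : ↥A ≃ ↥((Finset.univ \ D₀) \ P₀) := Equiv.ofBijective (fun q ↦ ⟨q.1.2, hQ ▸ Finset.mem_image_of_mem _ q.2⟩)
      ⟨fun q q' h ↦ Subtype.ext (hom.snd_injOn _ q.2 _ q'.2 (congrArg Subtype.val h)),
        fun b ↦ by
          have hb : (b : Fin (k + 1)) ∈ A.image Prod.snd := by rw [← hQ]; exact b.2
          obtain ⟨q, hq, hqb⟩ := Finset.mem_image.1 hb
          exact ⟨⟨q, hq⟩, Subtype.ext hqb⟩⟩ with hsndE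
    set β₀ : ↥P₀ ≃ ↥((Finset.univ \ D₀) \ P₀) := fstE.symm.trans sndE
    have hP₀ : P₀ ⊆ Finset.univ \ D₀ := by
      rw [univ_sdiff_densOf]; exact Finset.subset_union_left
    -- the graph of `β₀` is `A`
    have hgraph : graphOf D₀ P₀ β₀ = A := by
      ext q
      rw [mem_graphOf]
      constructor
      · rintro ⟨p, rfl⟩
        set q₀ := fstE.symm p with hq₀
        have h1 : (p : Fin (k + 1)) = q₀.1.1 := by
          have : fstE q₀ = p := fstE.apply_symm_apply p
          rw [← this]; rfl
        have h2 : ((β₀ p : ↥((Finset.univ \ D₀) \ P₀)) : Fin (k + 1)) = q₀.1.2 := rfl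
        rw [h1, h2]
        exact q₀.2
      · intro hq
        refine ⟨fstE ⟨q, hq⟩, ?_⟩
        have h1 : ((fstE ⟨q, hq⟩ : ↥P₀) : Fin (k + 1)) = q.1 := rfl
        have h2 : ((β₀ (fstE ⟨q, hq⟩) : ↥((Finset.univ \ D₀) \ P₀)) : Fin (k + 1)) = q.2 := by
          show ((sndE (fstE.symm (fstE ⟨q, hq⟩)) : ↥((Finset.univ \ D₀) \ P₀)) : Fin (k + 1)) = q.2
          rw [Equiv.symm_apply_apply]; rfl
        rw [h1, h2]
    refine ⟨⟨⟨D₀, P₀⟩, β₀⟩, ?_, hgraph⟩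
    rw [Finset.mem_sigma, Finset.mem_sigma]
    exact ⟨⟨Finset.mem_powerset.2 (Finset.subset_univ _), Finset.mem_powerset.2 hP₀⟩, Finset.mem_univ _⟩
  · -- the summands agree
    intro y hy
    rw [Finset.mem_sigma, Finset.mem_sigma] at hy
    exact pairInt_eq_matchInt_graphOf (Finset.mem_powerset.1 hy.1.2) y.2 Φ

end LHS

/-! ## The identification -/

/-- **The limit functional is `∫ Φ C_O`** (Rudnick–Sarnak 1996, (3.9) and (3.74)): for a continuous
compactly supported `Φ`, `frontLimit k Φ = rsPairingFunctional (k + 1) Φ`. [cite: RudnickSarnak1996, (3.9), (3.74)] -/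
theorem frontLimit_eq_rsPairingFunctional {Φ : (Fin (k + 1) → ℝ) → ℂ} (hΦc : Continuous Φ) (hΦs : HasCompactSupport Φ) :
    frontLimit k Φ = rsPairingFunctional (k + 1) Φ := by
  classical
  rw [frontLimit_eq_sum_matchInt, rsPairingFunctional_eq_sum_matchInt hΦc hΦs]

/-- **The limit of the windowed sums is `c_n ∫ Φ C_O`** (under RH): for an admissible `Φ`,
`W_Φ(T)/(T log T) → c_n ∫ Φ C_O`. [cite: RudnickSarnak1996, Thm. 3.1, (3.9)] -/
theorem tendsto_zeroSideSum_div_mul_log_rsPairing (hRH : RiemannHypothesis) {Φ : (Fin (k + 1) → ℝ) → ℂ}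
    (hΦ : IsRSAdmissiblePhi k Φ) :
    Tendsto (fun T : ℝ ↦ zeroSideSum Φ T / ((T : ℂ) * (Real.log T : ℂ))) atTop
      (𝓝 ((levelConst (k + 1) : ℂ) * rsPairingFunctional (k + 1) Φ)) := by
  rw [← frontLimit_eq_rsPairingFunctional hΦ.contDiff.continuous hΦ.hasCompactSupport]
  exact tendsto_zeroSideSum_div_mul_log hRH hΦ

end Unsmooth

end RudnickSarnakN

end Literature.NumberTheory.LFunctions

end
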